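import Literature.Computability.MetaComplexity.DepthFregeLocalRefutation
import Literature.Computability.MetaComplexity.ResolutionProofs
import Literature.Computability.MetaComplexity.XorificationLift
import HarnessLib

/-!
# Bounded-width resolution inside bounded-depth Frege: size `2^{O(w)} · poly`

Topic `Literature/Computability/MetaComplexity`. A resolution refutation `π` of width `≤ w` of a
CNF `φ` whose clauses have `≤ w` literals is a LOCAL REFUTATION in the sense of
`DepthFregeLocalRefutation.lean` (locality `2w`: a resolvent and its two premises mention at most
`2w` variables; `isLocalRefutation_of_isResRefutation`), hence (`IsLocalRefutation.
exists_isDepthProofOf`) `¬ ofCNF φ` has a depth-`17` `textbookFrege` proof of size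
`≤ 2^(2w+27) · (|φ| + |π| + 3w + 2)^6` (`exists_isDepthProofOf_of_isResRefutation`): the
folklore simulation of width-`w` resolution by bounded-depth Frege with every resolution step
replaced by a truth table over the `≤ 2w` variables involved.

Not here: the general p-simulation of (unbounded-width) resolution by depth-`2` Frege with cuts
on the pivots (Krajíček, *Proof complexity*, CUP 2019, §5.4 and Lemma 3.2.1), whose size does not
carry the factor `2^{O(w)}`.

References: J. Krajíček, *Proof complexity*, CUP 2019, §5.1 (resolution), §5.4 (width);
E. Ben-Sasson, A. Wigderson, J. ACM 48 (2001), §2.2.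
-/

namespace Literature.Computability.MetaComplexity

open Complexity Complexity.PropForm

/-! ### Set-clauses as list-clauses -/

/-- The list of a set-clause is true iff the set-clause is. [folklore] -/
theorem eval_toList_iff {ν : Type*} (σ : ν → Bool) (C : Finset (Literal ν)) :
    Clause.eval σ C.toList = true ↔ finsetClauseEval σ C := by
  simp only [Clause.eval, List.any_eq_true, Finset.mem_toList, finsetClauseEval]

/-- A clause is true iff its set of literals is. [folklore] -/
theorem finsetClauseEval_toFinset_iff {ν : Type*} [DecidableEq ν] (σ : ν → Bool) (c : Clause ν) :
    finsetClauseEval σ c.toFinset ↔ Clause.eval σ c = true := by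
  simp only [Clause.eval, List.any_eq_true, List.mem_toFinset, finsetClauseEval]

/-- The earlier members of a mapped list are in its prefix. [folklore] -/
theorem getElem_mem_take {α : Type*} {l : List α} {i k : ℕ} (hik : i < k) (hi : i < l.length) :
    l[i] ∈ l.take k := by
  rw [List.mem_iff_getElem]
  refine ⟨i, by simp [List.length_take]; omega, ?_⟩
  rw [List.getElem_take]

/-! ### Width-`w` resolution refutations are local refutations -/

/-- **A resolution refutation of width `≤ w` (of a CNF of width `≤ w`) is a local refutation**
with locality `2w` and width `w`, its clauses being the set-clauses of the lines as lists:
initial lines follow from their clause, weakenings from their premise, resolvents from their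
two premises (soundness of the rule), all over the `≤ 2w` variables of the premises.
[cite: KrajicekProofComplexity2019, §5.1 (soundness of the resolution rule)] -/
theorem isLocalRefutation_of_isResRefutation {φ : CNF ℕ} {π : List (ResLine ℕ)}
    (hπ : IsResRefutation φ π) {w : ℕ} (hw : resWidth π ≤ w) (hφ : ∀ c ∈ φ, c.length ≤ w) :
    IsLocalRefutation φ (2 * w) w (π.map fun l => l.clause.toList) := by
  classical
  have hwl : ∀ l ∈ π, l.clause.card ≤ w := resWidth_le_iff.1 hw
  refine ⟨fun k hk => ?_, fun C hC => ?_, hφ, ?_⟩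
  · -- the steps
    rw [List.length_map] at hk
    have e : (π.map fun l => l.clause.toList)[k]'(by simpa using hk) = (π[k]'hk).clause.toList :=
      List.getElem_map _
    rw [e]
    have hv := hπ.1 k hk
    have hkw : (π[k]'hk).clause.card ≤ w := hwl _ (List.getElem_mem hk)
    -- the variables of the current clause lie in the variables of any superset
    have hvars : ∀ (S : Finset (Literal ℕ)), ∀ l ∈ (π[k]'hk).clause.toList,
        (π[k]'hk).clause ⊆ S → l.1 ∈ (S.toList.map Prod.fst).dedup := fun S l hl hS => by
      rw [List.mem_dedup]
      exact List.mem_map.2 ⟨l, Finset.mem_toList.2 (hS (Finset.mem_toList.1 hl)), rfl⟩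
    unfold IsValidResLine at hv
    split at hv
    · -- initial
      obtain ⟨c, hc, hck⟩ := List.mem_map.1 hv
      refine ⟨c, c, (c.map Prod.fst).dedup, Or.inl hc, Or.inl hc, List.nodup_dedup _, ?_, ?_, ?_, ?_, ?_⟩
      · refine (List.Sublist.length_le (List.dedup_sublist _)).trans ?_
        rw [List.length_map]; exact (hφ c hc).trans (by omega)
      · intro l hl; rw [List.mem_dedup]; exact List.mem_map.2 ⟨l, hl, rfl⟩
      · intro l hl; rw [List.mem_dedup]; exact List.mem_map.2 ⟨l, hl, rfl⟩
      · intro l hl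
        rw [List.mem_dedup]
        rw [← hck, Finset.mem_toList, List.mem_toFinset] at hl
        exact List.mem_map.2 ⟨l, hl, rfl⟩
      · intro τ h1 _
        rw [eval_toList_iff, ← hck, finsetClauseEval_toFinset_iff]
        exact h1
    · -- resolvent
      rename_i i j v _
      obtain ⟨hi, hj, hres⟩ := hv
      have hi' : i < k ∧ i < π.length := by simpa [List.length_take] using hi
      have hj' : j < k ∧ j < π.length := by simpa [List.length_take] using hj
      rw [List.getElem_take, List.getElem_take] at hres
      set Ci := (π[i]'hi'.2).clause with hCi
      set Cj := (π[j]'hj'.2).clause with hCj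
      have hmi : Ci.toList ∈ (π.map fun l => l.clause.toList).take k := by
        have := getElem_mem_take (l := π.map fun l => l.clause.toList) hi'.1 (by simpa using hi'.2)
        simpa [hCi] using this
      have hmj : Cj.toList ∈ (π.map fun l => l.clause.toList).take k := by
        have := getElem_mem_take (l := π.map fun l => l.clause.toList) hj'.1 (by simpa using hj'.2)
        simpa [hCj] using this
      have hsub : (π[k]'hk).clause ⊆ Ci ∪ Cj := by
        rw [hres.2.2]
        exact Finset.union_subset_union (Finset.erase_subset _ _) (Finset.erase_subset _ _)
      refine ⟨Ci.toList, Cj.toList, ((Ci ∪ Cj).toList.map Prod.fst).dedup, Or.inr hmi, Or.inr hmj,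
        List.nodup_dedup _, ?_, ?_, ?_, fun l hl => hvars _ l hl hsub, ?_⟩
      · refine (List.Sublist.length_le (List.dedup_sublist _)).trans ?_
        rw [List.length_map, Finset.length_toList]
        have h1 := hwl _ (List.getElem_mem hi'.2)
        have h2 := hwl _ (List.getElem_mem hj'.2)
        exact (Finset.card_union_le _ _).trans (by rw [← hCi, ← hCj] at *; omega)
      · intro l hl
        rw [List.mem_dedup]
        exact List.mem_map.2 ⟨l, Finset.mem_toList.2 (Finset.mem_union_left _ (Finset.mem_toList.1 hl)), rfl⟩
      · intro l hl
        rw [List.mem_dedup]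
        exact List.mem_map.2 ⟨l, Finset.mem_toList.2 (Finset.mem_union_right _ (Finset.mem_toList.1 hl)), rfl⟩
      · intro τ h1 h2
        rw [eval_toList_iff] at h1 h2 ⊢
        exact finsetClauseEval_of_isResolvent hres h1 h2
    · -- weakening
      rename_i i _
      obtain ⟨hi, hsubset⟩ := hv
      have hi' : i < k ∧ i < π.length := by simpa [List.length_take] using hi
      rw [List.getElem_take] at hsubset
      set Ci := (π[i]'hi'.2).clause with hCi
      have hmi : Ci.toList ∈ (π.map fun l => l.clause.toList).take k := by
        have := getElem_mem_take (l := π.map fun l => l.clause.toList) hi'.1 (by simpa using hi'.2)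
        simpa [hCi] using this
      refine ⟨Ci.toList, Ci.toList, ((π[k]'hk).clause.toList.map Prod.fst).dedup, Or.inr hmi, Or.inr hmi,
        List.nodup_dedup _, ?_, ?_, ?_, fun l hl => hvars _ l hl (subset_refl _), ?_⟩
      · refine (List.Sublist.length_le (List.dedup_sublist _)).trans ?_
        rw [List.length_map, Finset.length_toList]; omega
      · intro l hl
        rw [List.mem_dedup]
        exact List.mem_map.2 ⟨l, Finset.mem_toList.2 (hsubset (Finset.mem_toList.1 hl)), rfl⟩
      · intro l hl
        rw [List.mem_dedup]
        exact List.mem_map.2 ⟨l, Finset.mem_toList.2 (hsubset (Finset.mem_toList.1 hl)), rfl⟩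
      · intro τ h1 _
        rw [eval_toList_iff] at h1 ⊢
        exact finsetClauseEval_of_subset h1 hsubset
  · -- widths
    obtain ⟨l, hl, rfl⟩ := List.mem_map.1 hC
    rw [Finset.length_toList]; exact hwl l hl
  · -- the empty clause
    obtain ⟨l, hl, hl0⟩ := hπ.2
    exact List.mem_map.2 ⟨l, hl, by rw [hl0, Finset.toList_empty]⟩

/-- **Width-`w` resolution has bounded-depth Frege proofs of size `2^{O(w)} · poly`.** A
resolution refutation `π` of width `≤ w` of a CNF `φ` all of whose clauses have `≤ w` literals
yields a depth-`17` `textbookFrege` proof of `¬ ofCNF φ` of size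
`≤ 2^(2w+27) · (|φ| + |π| + 3w + 2)^6`. [cite: KrajicekProofComplexity2019, §5.4 (width; bounded-width resolution inside bounded-depth systems)] -/
theorem exists_isDepthProofOf_of_isResRefutation {φ : CNF ℕ} {π : List (ResLine ℕ)}
    (hπ : IsResRefutation φ π) {w : ℕ} (hw : resWidth π ≤ w) (hφ : ∀ c ∈ φ, c.length ≤ w) :
    ∃ π', textbookFrege.IsDepthProofOf 17 π' (neg (ofCNF φ)) ∧
      proofSize π' ≤ 2 ^ (2 * w + 27) * (φ.length + π.length + 3 * w + 2) ^ 6 := by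
  obtain ⟨π', hπ', hsize⟩ := (isLocalRefutation_of_isResRefutation hπ hw hφ).exists_isDepthProofOf
  refine ⟨π', hπ', hsize.trans ?_⟩
  rw [List.length_map]
  exact Nat.mul_le_mul_left _ (Nat.pow_le_pow_left (by omega) 6)

end Literature.Computability.MetaComplexity
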